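import Summits.QuantumFields.YangMills.Theorems.BalabanUVNodesN08AlphaAbelianWindow

/-!
# Route «BalabanUVNodes», Track-A DAG node N08 = [Balaban1985UV3] — (α) clause, the in-edge sentence (b11‴) CONSTRUCTED, part 2c:
# THE CONE BOX OF A COARSE BOND — tameness of the dependency cone from a fine curvature bound

Cell `pub-ymgap`, seat `pub-ymgap-dag-n08-d` gen 5, file F2c (over F2b `…N08AlphaAbelianWindow`).  `bears_on: R4∕N08`; filed `--supports
stmt-QuantumFields-19910 --as helper`.  Sorry-free, standard axioms.

CONTENTS ([folklore] bookkeeping): the CONE BOX `[L^j z, L^j z + (L^j − 1)𝟙 + L^j e_κ]` of the level-`j` bond `(z, κ)` (print's `B^j(c₋) ∪ B^j(c₊)`,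
[4] p. 24; the tree's `[loK L j z, bondHiK L j z κ]`) contains the windows of all the plaquettes and the cone boxes of all the bonds the recursion
(43) reads (`inWindow_of_subBond`, `coneBox_of_subBond`); hence ★ `coneTame_of_curl_bound`: a uniform bound `|curl a| ≤ m` on the cone box with the
level budget `d·L²·(L^{j−1})²·m·‖X‖ < log 2` makes the cone TAME (F2's `ConeTame`), so that F2's exact form `Ū^j(abelCfg X a) = abelCfg X (linAvgIter L a j)`
holds at the bond.
HONEST FRAMING: kernel bookkeeping for TEST configurations; nothing of [B10] ∕ [7] ∕ [4]'s estimates asserted; count-neutral; NOT a discharge of N08.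
-/

noncomputable section

namespace Summit.QuantumFields.YangMills.Theorems.BalabanUVNodesN08AlphaAbelianCone

open scoped BigOperators
open Literature.MathematicalPhysics.QuantumFieldTheory.Balaban1983to89
open B7Prop1Explicit
open B7Prop1Local (InBox bondHi)
open Summit.QuantumFields.YangMills.Theorems.BalabanUVNodesN08AlphaAbelianLift
open Summit.QuantumFields.YangMills.Theorems.BalabanUVNodesN08AlphaAbelianAverage
open Summit.QuantumFields.YangMills.Theorems.BalabanUVNodesN08AlphaAbelianWindow

variable {d : ℕ} (L : ℕ)

/-- **THE FINE CONE BOX OF THE LEVEL-`j` BOND `(z, κ)`**: `L^j z_i ≤ x_i ≤ L^j z_i + (L^j − 1) + L^j[i = κ]` (= `B^j(c₋) ∪ B^j(c₊)`).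
[cite: Balaban1985Averaging, p.24 (locality after (43))] -/
def ConeBox (j : ℕ) (z : Site d) (κ : Fin d) (x : Site d) : Prop :=
  ∀ i, (L : ℤ) ^ j * z i ≤ x i ∧ x i ≤ (L : ℤ) ^ j * z i + ((L : ℤ) ^ j - 1) + (if i = κ then (L : ℤ) ^ j else 0)

/-- The window of a plaquette `(x′; ν′, κ)` whose corners `x′, x′ + e_ν′ + e_κ` lie in the `L`-box `[Lz, bondHi L (Lz) κ]` of the level-`(j+1)` bond `(z, κ)`
(read at level `j`) is inside the cone box of `(z, κ)` at level `j+1`. [folklore] -/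
theorem inWindow_of_subPlaq (hL : 1 ≤ L) (j : ℕ) (z : Site d) (κ : Fin d) {x' : Site d} {ν' : Fin d}
    (hx' : InBox ((L : ℤ) • z) (bondHi L ((L : ℤ) • z) κ) x') (hx'e : InBox ((L : ℤ) • z) (bondHi L ((L : ℤ) • z) κ) (x' + e ν' + e κ))
    {x : Site d} (hx : InWindow L j x' ν' κ x) : ConeBox L (j + 1) z κ x := by
  intro c
  have h1 := (hx' c).1
  have h2 := (hx'e c).2
  have hw := hx c
  have hLj : (1 : ℤ) ≤ (L : ℤ) ^ j := by exact_mod_cast Nat.one_le_pow _ _ hL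
  simp only [bondHi, Pi.add_apply, Pi.smul_apply, smul_eq_mul, e_apply] at h1 h2
  rw [pow_succ]
  constructor
  · nlinarith [hw.1]
  · have hw2 := hw.2
    split_ifs at h2 hw2 ⊢ <;> nlinarith

/-- The cone box of a bond `(y, μ′)` with `y, y + e_μ′ ∈ [Lz, bondHi L (Lz) κ]` (level `j`) is inside the cone box of `(z, κ)` at level `j+1`. [folklore] -/
theorem coneBox_of_subBond (hL : 1 ≤ L) (j : ℕ) (z : Site d) (κ : Fin d) {y : Site d} {μ' : Fin d}
    (hy : InBox ((L : ℤ) • z) (bondHi L ((L : ℤ) • z) κ) y) (hye : InBox ((L : ℤ) • z) (bondHi L ((L : ℤ) • z) κ) (y + e μ'))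
    {x : Site d} (hx : ConeBox L j y μ' x) : ConeBox L (j + 1) z κ x := by
  intro c
  have h1 := (hy c).1
  have h2 := (hye c).2
  have hw := hx c
  have hLj : (1 : ℤ) ≤ (L : ℤ) ^ j := by exact_mod_cast Nat.one_le_pow _ _ hL
  simp only [bondHi, Pi.add_apply, Pi.smul_apply, smul_eq_mul, e_apply] at h1 h2
  rw [pow_succ]
  constructor
  · nlinarith [hw.1]
  · have hw2 := hw.2
    split_ifs at h2 hw2 ⊢ <;> nlinarith

variable {𝔸 : Type*} [NormedRing 𝔸]

/-- **★ TAMENESS OF THE CONE FROM A FINE CURVATURE BOUND**: if `|curl a| ≤ m` on the cone box of the level-`j` bond `(z, κ)` and the level budget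
`d·L²·(L^j)²·m·‖X‖ < log 2` holds (it dominates the budgets `d·L²·(L^i)²·m·‖X‖` of all levels `i < j` actually read), then `ConeTame L X a j z κ`.
[cite: Balaban1985Averaging, (42)–(43) pp.23–24 + (47)–(49) p.25] -/
theorem coneTame_of_curl_bound (hL : 1 ≤ L) (X : 𝔸) (a : Site d → Fin d → ℝ) {m : ℝ} (hm : 0 ≤ m) :
    ∀ (j : ℕ) (z : Site d) (κ : Fin d), (∀ x, ConeBox L j z κ x → ∀ μ ν, |curl a x μ ν| ≤ m) →
      (d : ℝ) * (L : ℝ) ^ 2 * (((L : ℝ) ^ j) ^ 2 * m) * ‖X‖ < Real.log 2 → ConeTame L X a j z κ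
  | 0, _, _, _, _ => trivial
  | j + 1, z, κ, hbox, hbud => by
    have hL1 : (1 : ℝ) ≤ L := by exact_mod_cast hL
    have hbudj : (d : ℝ) * (L : ℝ) ^ 2 * (((L : ℝ) ^ j) ^ 2 * m) * ‖X‖ < Real.log 2 := by
      refine lt_of_le_of_lt ?_ hbud
      have : ((L : ℝ) ^ j) ^ 2 ≤ ((L : ℝ) ^ (j + 1)) ^ 2 := by gcongr; exacts [Nat.le_succ j]
      have hd : (0 : ℝ) ≤ d := Nat.cast_nonneg d
      have : (d : ℝ) * (L : ℝ) ^ 2 * (((L : ℝ) ^ j) ^ 2 * m) ≤ (d : ℝ) * (L : ℝ) ^ 2 * (((L : ℝ) ^ (j + 1)) ^ 2 * m) := by gcongr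
      exact mul_le_mul_of_nonneg_right this (norm_nonneg X)
    refine ⟨fun r => ?_, fun y μ' hy hye => ?_⟩
    · -- the contour fluxes of the level-`j` iterate at the `L`-bond below `(z, κ)`
      have hcurl : ∀ (x' : Site d) (ν' : Fin d), InBox ((L : ℤ) • z) (bondHi L ((L : ℤ) • z) κ) x' →
          InBox ((L : ℤ) • z) (bondHi L ((L : ℤ) • z) κ) (x' + e ν' + e κ) → |curl (linAvgIter L a j) x' ν' κ| ≤ ((L : ℝ) ^ j) ^ 2 * m :=
        fun x' ν' hx' hx'e => abs_curl_linAvgIter_le L hL ν' κ hm j x' fun x hx =>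
          hbox x (inWindow_of_subPlaq L hL j z κ hx' hx'e hx) ν' κ
      have hflux := abs_wflux_le L hL (linAvgIter L a j) ((L : ℤ) • z) κ r (by positivity) hcurl
      calc |wflux L (linAvgIter L a j) ((L : ℤ) • z) κ (boxVec L r)| * ‖X‖ ≤ (d * (L : ℝ) ^ 2 * (((L : ℝ) ^ j) ^ 2 * m)) * ‖X‖ :=
            mul_le_mul_of_nonneg_right hflux (norm_nonneg X)
        _ < Real.log 2 := hbudj
    · exact coneTame_of_curl_bound hL X a hm j y μ' (fun x hx => hbox x (coneBox_of_subBond L hL j z κ hy hye hx)) hbudj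

end Summit.QuantumFields.YangMills.Theorems.BalabanUVNodesN08AlphaAbelianCone

end
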